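import Summits.Ventures.CertifiedManyBodySolver.Observables.BoxRowBraggCeilings
import HarnessLib

/-!
# The phase-separation dictionary: a translation-averaged MIXTURE of two states with different densities carries
# a `q = 0` density Bragg weight `≥ t(1−t)(n₁ − n₂)²` — so a certified ceiling on the density box functional
# EXCLUDES macroscopic phase separation of that contrast

HONEST FRAMING: first certified bounds on pairing observables; not a superconductivity verdict; every number certified
(two lineages + referee) or labelled float.  Cell hubbard-obs (D-0042 crew 1), seat hubbard-obs-p3 (CONTROLS), gen 2 —
the reading of the `q = 0` CONNECTED DENSITY box row `F_c3` of the controls menu (HOME/hubbard-obs-p3/TARGET.md §3 C2.5;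
tree `densityFluct_braggWeight_le_box3`).  Pure state positivity + harmonic analysis; zero compute; NO definition, no named
fact, no `sorry`.

Dictionary «phase separation at density `7/8` ⇒ the translation-averaged torus limit is a MIXTURE `t·ω₁ + (1−t)·ω₂` of two
translation-invariant states with densities `n₁ ≠ n₂`, `t n₁ + (1−t) n₂ = 7/8`» (e.g. Emery–Kivelson-type separation into
`n = 1` and `n = 3/4` halves).  For such a mixture the `D₄`-orbit-mean CONNECTED density correlation centred at `7/8`
(`Certificates.chargeOrbitCorr`, the function every density box row is read through) decomposes as

  `chargeOrbitCorr (mix t ω₁ ω₂) = t·P₁ + (1−t)·P₂ + t(1−t)(n₁−n₂)²`,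

`Pᵢ` = the orbit-mean connected correlation of `ωᵢ` at ITS OWN density (positive definite, `isPositiveDefinite_corr_oneSite`)
(`chargeOrbitCorr_mix`, `corr_Dc_shift_eq_conn_add_sq`).  Hence (`densityFluct_braggWeight_ge_of_mix`): for EVERY finite
measure `μ` representing `chargeOrbitCorr (mix t ω₁ ω₂)`,

  **`braggWeight μ ![0] ≥ t(1−t)(n₁ − n₂)²`**

(represent `t·P₁ + (1−t)·P₂` by Herglotz, add `t(1−t)(n₁−n₂)²·δ₀`, and use that Bragg weights do not depend on the
representing measure, `braggWeight_single_eq_of_representing`).  Contrapositive = the reading: a certified UPPER row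
`F_c3 − 49/64 ≤ U` on the connected `3 × 3` density box functional gives `μ(2πℤ²) ≤ U` (`densityFluct_braggWeight_le_box3`),
so every mixture scenario with `t(1−t)(n₁−n₂)² > U` is EXCLUDED for the torus-limit ground states of the row's class
(`not_mix_of_densityFluct_ceiling`).  Yardstick: `t = ½`, `n₁ − n₂ = ¼` needs `U < 1/64 = 0.015625`; the STEP-0 float is
`≈ 0.10` [float] — the row with teeth lives on larger footprints (`1/|B|` law).  A ceiling says nothing about the presence of
order; this file asserts no number.

References: Emery–Kivelson–Lin, PRL 64 (1990) 475 (phase separation); Bratteli–Robinson I §4.3.1 (convexity, invariant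
states); Katznelson, *An Introduction to Harmonic Analysis* (2004) I.7.
-/

noncomputable section

open MeasureTheory Complex Filter Topology
open scoped Real BigOperators NNReal ENNReal

namespace Summit.Ventures.CertifiedManyBodySolver.Observables

/-! ## §1  Measures: adding an atom at the origin -/

section Measures

variable {d : ℕ} {C : (Fin d → ℤ) → ℂ} (μ : Measure (EuclideanSpace ℝ (Fin d))) [IsFiniteMeasure μ]

/-- `0 ∈ 2πℤᵈ`. [folklore] -/
theorem zero_mem_braggSet_zero : (0 : EuclideanSpace ℝ (Fin d)) ∈ braggSet (0 : Fin d → ℝ) :=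
  ⟨0, fun i => by simp⟩

/-- Adding the atom `c·δ₀` adds the constant `c` to every moment: if `μ` represents `C` then `μ + c·δ₀` represents
`r ↦ C r + c`. [cite: Katznelson2004, I.7] -/
theorem represents_add_dirac
    (hμ : ∀ r : Fin d → ℤ, ∫ ξ, exp ((∑ i, (r i : ℝ) * ξ i : ℝ) * I) ∂μ = C r) (c : ℝ≥0) (r : Fin d → ℤ) :
    ∫ ξ, exp ((∑ i, (r i : ℝ) * ξ i : ℝ) * I) ∂(μ + c • Measure.dirac (0 : EuclideanSpace ℝ (Fin d))) =
      C r + (c : ℝ) := by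
  have hint : ∀ (κ : Measure (EuclideanSpace ℝ (Fin d))) [IsFiniteMeasure κ],
      Integrable (fun ξ : EuclideanSpace ℝ (Fin d) => exp ((∑ i, (r i : ℝ) * ξ i : ℝ) * I)) κ :=
    fun κ _ => integrable_exp_ofReal_mul_I κ (by fun_prop)
  rw [integral_add_measure (hint μ) (hint _), hμ r, integral_smul_nnreal_measure, integral_dirac]
  have h0 : exp ((∑ i, (r i : ℝ) * (0 : EuclideanSpace ℝ (Fin d)) i : ℝ) * I) = 1 := by simp
  rw [h0, NNReal.smul_def, Complex.real_smul, mul_one]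

/-- The atom adds its mass to the Bragg weight at `0`: `braggWeight (μ + c·δ₀) ![0] = braggWeight μ ![0] + c`. [folklore] -/
theorem braggWeight_add_dirac_zero (c : ℝ≥0) :
    braggWeight (μ + c • Measure.dirac (0 : EuclideanSpace ℝ (Fin d))) ![(0 : Fin d → ℝ)] =
      braggWeight μ ![(0 : Fin d → ℝ)] + (c : ℝ) := by
  rw [braggWeight_single, braggWeight_single, Measure.real, Measure.real, Measure.add_apply, Measure.smul_apply,
    Measure.dirac_apply_of_mem zero_mem_braggSet_zero, ENNReal.toReal_add (measure_ne_top _ _) (by simp)]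
  simp

/-- A convex combination of representing measures represents the convex combination. [cite: Katznelson2004, I.7] -/
theorem represents_convexComb {C₁ C₂ : (Fin d → ℤ) → ℂ}
    (μ₁ μ₂ : Measure (EuclideanSpace ℝ (Fin d))) [IsFiniteMeasure μ₁] [IsFiniteMeasure μ₂]
    (h₁ : ∀ r : Fin d → ℤ, ∫ ξ, exp ((∑ i, (r i : ℝ) * ξ i : ℝ) * I) ∂μ₁ = C₁ r)
    (h₂ : ∀ r : Fin d → ℤ, ∫ ξ, exp ((∑ i, (r i : ℝ) * ξ i : ℝ) * I) ∂μ₂ = C₂ r) (a b : ℝ≥0) (r : Fin d → ℤ) :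
    ∫ ξ, exp ((∑ i, (r i : ℝ) * ξ i : ℝ) * I) ∂(a • μ₁ + b • μ₂) = (a : ℝ) * C₁ r + (b : ℝ) * C₂ r := by
  have hint : ∀ (κ : Measure (EuclideanSpace ℝ (Fin d))) [IsFiniteMeasure κ],
      Integrable (fun ξ : EuclideanSpace ℝ (Fin d) => exp ((∑ i, (r i : ℝ) * ξ i : ℝ) * I)) κ :=
    fun κ _ => integrable_exp_ofReal_mul_I κ (by fun_prop)
  rw [integral_add_measure (hint _) (hint _), integral_smul_nnreal_measure, integral_smul_nnreal_measure, h₁ r, h₂ r]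
  simp only [NNReal.smul_def, Complex.real_smul]

end Measures

/-! ## §2  States: mixtures and the centred density correlation -/

section States

open Matrix Literature.MathematicalPhysics.QuantumLattice Literature.Probability.LatticeModels
open Summit.Ventures.CertifiedManyBodySolver.Certificates
open Summit.Ventures.CertifiedManyBodySolver.Transport

variable {t : ℝ} (ht₀ : 0 ≤ t) (ht₁ : t ≤ 1) (ω₁ ω₂ : InfVolFermionState 2)

/-- Two-point functions are affine in the state: `corr (t ω₁ + (1−t) ω₂) A B = t·corr ω₁ A B + (1−t)·corr ω₂ A B`.
[cite: BratteliRobinsonI1987, §4.3.1] -/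
theorem corr_mix {Λ₁ Λ₂ : Finset (Site 2)} (A : FermionOp Λ₁) (B : FermionOp Λ₂) :
    (InfVolFermionState.mix t ht₀ ht₁ ω₁ ω₂).corr A B = (t : ℂ) * ω₁.corr A B + ((1 - t : ℝ) : ℂ) * ω₂.corr A B := by
  simp only [InfVolFermionState.corr_eq, InfVolFermionState.mix_expect]

/-- `chargeOrbitCorr` is affine in the state. [cite: BratteliRobinsonI1987, §4.3.1] -/
theorem chargeOrbitCorr_mix (r : Site 2) :
    chargeOrbitCorr (InfVolFermionState.mix t ht₀ ht₁ ω₁ ω₂) r =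
      (t : ℂ) * chargeOrbitCorr ω₁ r + ((1 - t : ℝ) : ℂ) * chargeOrbitCorr ω₂ r := by
  unfold chargeOrbitCorr
  simp only [corr_mix, Finset.sum_add_distrib, mul_add, Finset.mul_sum]
  congr 1 <;> exact Finset.sum_congr rfl fun g _ => by ring

/-- The density is affine in the state. [cite: BratteliRobinsonI1987, §4.3.1] -/
theorem density_mix :
    (InfVolFermionState.mix t ht₀ ht₁ ω₁ ω₂).density = t * ω₁.density + (1 - t) * ω₂.density := by
  unfold InfVolFermionState.density InfVolFermionState.densityAt
  rw [InfVolFermionState.mix_expect, Complex.add_re, Complex.re_ofReal_mul, Complex.re_ofReal_mul]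

variable {ω : InfVolFermionState 2}

/-- The centred density `n₀ − ρ` at the origin is Hermitian. [folklore] -/
theorem conjTranspose_NAt_sub (ρ : ℝ) :
    (NAt (0 : Site 2) (Finset.mem_singleton_self 0) - (ρ : ℂ) • (1 : FermionOp ({0} : Finset (Site 2))))ᴴ =
      NAt 0 (Finset.mem_singleton_self 0) - (ρ : ℂ) • 1 := by
  have h0 : (nAt (0 : Site 2) (Finset.mem_singleton_self 0) 0 : FermionOp ({0} : Finset (Site 2)))ᴴ =
      nAt 0 (Finset.mem_singleton_self 0) 0 := (numberAt_isHermitian _).eq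
  have h1 : (nAt (0 : Site 2) (Finset.mem_singleton_self 0) 1 : FermionOp ({0} : Finset (Site 2)))ᴴ =
      nAt 0 (Finset.mem_singleton_self 0) 1 := (numberAt_isHermitian _).eq
  rw [NAt, Matrix.conjTranspose_sub, Matrix.conjTranspose_add, h0, h1, Matrix.conjTranspose_smul,
    Matrix.conjTranspose_one, Complex.star_def, Complex.conj_ofReal]

/-- `ω(n₀) = ρ(ω)` as a complex number (the expectation of the Hermitian `n₀` is real). [folklore] -/
theorem expect_NAt_eq_density (ω : InfVolFermionState 2) :
    ω.expect {0} (NAt (0 : Site 2) (Finset.mem_singleton_self 0)) = (ω.density : ℂ) := by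
  have hherm : (NAt (0 : Site 2) (Finset.mem_singleton_self 0) : FermionOp ({0} : Finset (Site 2))).IsHermitian := by
    have h := conjTranspose_NAt_sub (0 : ℝ)
    simp only [Complex.ofReal_zero, zero_smul, sub_zero] at h
    exact h
  apply Complex.ext
  · rfl
  · rw [Complex.ofReal_im]; exact ω.expect_im_eq_zero_of_isHermitian hherm

/-- For translation-invariant `ω` of density `ρ`: the centred density has mean zero in every translate,
`ω_{ {v} }(Γ(τ_v)(n₀ − ρ)) = 0`. [cite: ArakiMoriya2003, §4.1 Def. 4.5] -/
theorem expect_shift_NAt_sub_density (hω : ω.IsTranslationInvariant) (v : Site 2) :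
    ω.expect (shiftSet v {0}) (fermionEmbed (PolySite.shiftEmb v {0})
      (NAt (0 : Site 2) (Finset.mem_singleton_self 0) - (ω.density : ℂ) • (1 : FermionOp ({0} : Finset (Site 2))))) = 0 := by
  rw [← InfVolFermionState.shift_expect, hω v, map_sub, map_smul, ω.expect_one, expect_NAt_eq_density, smul_eq_mul,
    mul_one, sub_self]

/-- **Re-centring**: for translation-invariant `ω` with density `ρ`, the two-point function of the `7/8`-centred density
`D = n₀ − 7/8` is that of the `ρ`-centred density PLUS the constant `(ρ − 7/8)²`:
`ω(D · τ_v D) = ω((n₀−ρ) · τ_v(n₀−ρ)) + (ρ − 7/8)²` (the cross terms vanish because `ω(n₀ − ρ) = 0`).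
[cite: BratteliRobinsonI1987, §4.3.1] -/
theorem corr_Dc_shift_eq_conn_add_sq (hω : ω.IsTranslationInvariant) (v : Site 2) :
    ω.corr Dc (fermionEmbed (PolySite.shiftEmb v {0}) Dc) =
      ω.corr (NAt (0 : Site 2) (Finset.mem_singleton_self 0) - (ω.density : ℂ) • (1 : FermionOp ({0} : Finset (Site 2))))
          (fermionEmbed (PolySite.shiftEmb v {0})
            (NAt (0 : Site 2) (Finset.mem_singleton_self 0) - (ω.density : ℂ) • (1 : FermionOp ({0} : Finset (Site 2))))) +
        (((ω.density - 7/8) ^ 2 : ℝ) : ℂ) := by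
  set Dn : FermionOp ({0} : Finset (Site 2)) :=
    NAt (0 : Site 2) (Finset.mem_singleton_self 0) - (ω.density : ℂ) • (1 : FermionOp ({0} : Finset (Site 2))) with hDn
  set a : ℂ := ((ω.density - 7/8 : ℝ) : ℂ) with ha
  have hDc : Dc = Dn + a • (1 : FermionOp ({0} : Finset (Site 2))) := by
    rw [Dc, hDn, ha]; push_cast
    rw [sub_smul, sub_add_sub_cancel]
  -- the means of `Dn` and of its translate vanish in the common region
  have e1 : ω.expect ({0} ∪ shiftSet v {0}) (fermionEmbed (PolySite.incl Finset.subset_union_left) Dn) = 0 := by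
    rw [ω.compatible, hDn, map_sub, map_smul, ω.expect_one, expect_NAt_eq_density, smul_eq_mul, mul_one, sub_self]
  have e2 : ω.expect ({0} ∪ shiftSet v {0}) (fermionEmbed (PolySite.incl Finset.subset_union_right)
      (fermionEmbed (PolySite.shiftEmb v {0}) Dn)) = 0 := by
    rw [ω.compatible, hDn]; exact expect_shift_NAt_sub_density hω v
  rw [InfVolFermionState.corr_eq, InfVolFermionState.corr_eq, hDc]
  simp only [map_add, map_smul, map_one, add_mul, mul_add, smul_mul_assoc, mul_smul_comm, one_mul, mul_one,
    smul_eq_mul, e1, e2, ω.expect_one, mul_zero, add_zero, zero_add]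
  rw [ha]; push_cast; ring

/-- The `D₄`-orbit-mean connected density correlation of `ω` at ITS OWN density `ρ`, written out:
`P_ω(r) = 8⁻¹ Σ_γ ω((n₀−ρ)·τ_{γr}(n₀−ρ))` — positive definite for translation-invariant `ω`.
[cite: BratteliRobinsonI1987, Cor. 2.3.17 and §4.3.1] -/
theorem isPositiveDefinite_connOrbitCorr (hω : ω.IsTranslationInvariant) :
    Literature.Analysis.FunctionSpaces.IsPositiveDefinite (fun r : Site 2 => (((8 : ℝ)⁻¹ : ℝ) : ℂ) *
      ∑ g : DihedralGroup 4, ω.corr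
        (NAt (0 : Site 2) (Finset.mem_singleton_self 0) - (ω.density : ℂ) • (1 : FermionOp ({0} : Finset (Site 2))))
        (fermionEmbed (PolySite.shiftEmb (d4Vec g r) {0})
          (NAt (0 : Site 2) (Finset.mem_singleton_self 0) - (ω.density : ℂ) • (1 : FermionOp ({0} : Finset (Site 2)))))) := by
  set Dn : FermionOp ({0} : Finset (Site 2)) :=
    NAt (0 : Site 2) (Finset.mem_singleton_self 0) - (ω.density : ℂ) • (1 : FermionOp ({0} : Finset (Site 2))) with hDn
  have h0 : Literature.Analysis.FunctionSpaces.IsPositiveDefinite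
      (fun r : Site 2 => ω.corr Dn (fermionEmbed (PolySite.shiftEmb r {0}) Dn)) := by
    have h := hω.isPositiveDefinite_corr_oneSite Dn
    rw [hDn, conjTranspose_NAt_sub] at h
    exact h
  have h1 : ∀ g : DihedralGroup 4, Literature.Analysis.FunctionSpaces.IsPositiveDefinite
      (fun r : Site 2 => ω.corr Dn (fermionEmbed (PolySite.shiftEmb (d4Vec g r) {0}) Dn)) :=
    fun g => isPositiveDefinite_comp_d4Vec h0 g
  have h2 := Literature.Analysis.FunctionSpaces.IsPositiveDefinite.sum Finset.univ (fun g _ => h1 g)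
  exact h2.real_smul (r := (8 : ℝ)⁻¹) (by norm_num)

/-- **The decomposition of the mixture's `7/8`-centred orbit correlation**: for translation-invariant `ω₁, ω₂`,
`chargeOrbitCorr (mix t ω₁ ω₂) r = t·P₁(r) + (1−t)·P₂(r) + [t(ρ₁−7/8)² + (1−t)(ρ₂−7/8)²]`.
[cite: BratteliRobinsonI1987, §4.3.1] -/
theorem chargeOrbitCorr_mix_eq (hω₁ : ω₁.IsTranslationInvariant) (hω₂ : ω₂.IsTranslationInvariant) (r : Site 2) :
    chargeOrbitCorr (InfVolFermionState.mix t ht₀ ht₁ ω₁ ω₂) r =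
      (t : ℂ) * ((((8 : ℝ)⁻¹ : ℝ) : ℂ) * ∑ g : DihedralGroup 4, ω₁.corr
        (NAt (0 : Site 2) (Finset.mem_singleton_self 0) - (ω₁.density : ℂ) • (1 : FermionOp ({0} : Finset (Site 2))))
        (fermionEmbed (PolySite.shiftEmb (d4Vec g r) {0})
          (NAt (0 : Site 2) (Finset.mem_singleton_self 0) - (ω₁.density : ℂ) • (1 : FermionOp ({0} : Finset (Site 2)))))) +
      ((1 - t : ℝ) : ℂ) * ((((8 : ℝ)⁻¹ : ℝ) : ℂ) * ∑ g : DihedralGroup 4, ω₂.corr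
        (NAt (0 : Site 2) (Finset.mem_singleton_self 0) - (ω₂.density : ℂ) • (1 : FermionOp ({0} : Finset (Site 2))))
        (fermionEmbed (PolySite.shiftEmb (d4Vec g r) {0})
          (NAt (0 : Site 2) (Finset.mem_singleton_self 0) - (ω₂.density : ℂ) • (1 : FermionOp ({0} : Finset (Site 2)))))) +
      (((t * (ω₁.density - 7/8) ^ 2 + (1 - t) * (ω₂.density - 7/8) ^ 2 : ℝ)) : ℂ) := by
  rw [chargeOrbitCorr_mix]
  unfold chargeOrbitCorr
  simp only [corr_Dc_shift_eq_conn_add_sq hω₁, corr_Dc_shift_eq_conn_add_sq hω₂, Finset.sum_add_distrib,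
    Finset.sum_const, Finset.card_univ, DihedralGroup.card, nsmul_eq_mul]
  push_cast
  ring

end States

/-! ## §3  The floor -/

section Floor

open Matrix Literature.MathematicalPhysics.QuantumLattice Literature.Probability.LatticeModels
open Summit.Ventures.CertifiedManyBodySolver.Certificates
open Summit.Ventures.CertifiedManyBodySolver.Transport

/-- **Phase-separation floor on the `q = 0` density Bragg weight.**  Let `ω₁, ω₂` be translation-invariant states on `ℤ²`
with densities `ρ₁, ρ₂` and let `t ∈ [0,1]` with `t ρ₁ + (1−t) ρ₂ = 7/8`.  Then for EVERY finite measure `μ` representing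
the `7/8`-centred orbit-mean density correlation of the mixture `t ω₁ + (1−t) ω₂`:
`braggWeight μ ![0] ≥ t(1−t)(ρ₁ − ρ₂)²`. [cite: BratteliRobinsonI1987, §4.3.1] -/
theorem densityFluct_braggWeight_ge_of_mix {t : ℝ} (ht₀ : 0 ≤ t) (ht₁ : t ≤ 1) (ω₁ ω₂ : InfVolFermionState 2)
    (hω₁ : ω₁.IsTranslationInvariant) (hω₂ : ω₂.IsTranslationInvariant)
    (hρ : t * ω₁.density + (1 - t) * ω₂.density = 7/8)
    (μ : Measure (EuclideanSpace ℝ (Fin 2))) [IsFiniteMeasure μ]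
    (hμ : ∀ r : Site 2, ∫ ξ, exp ((∑ i, (r i : ℝ) * ξ i : ℝ) * I) ∂μ =
      chargeOrbitCorr (InfVolFermionState.mix t ht₀ ht₁ ω₁ ω₂) r) :
    t * (1 - t) * (ω₁.density - ω₂.density) ^ 2 ≤ braggWeight μ ![(0 : Fin 2 → ℝ)] := by
  -- represent the two connected parts (Herglotz)
  obtain ⟨ν₁, hf₁, hν₁⟩ := (isPositiveDefinite_connOrbitCorr hω₁).exists_measure_integral_exp_eq
  obtain ⟨ν₂, hf₂, hν₂⟩ := (isPositiveDefinite_connOrbitCorr hω₂).exists_measure_integral_exp_eq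
  set c : ℝ := t * (ω₁.density - 7/8) ^ 2 + (1 - t) * (ω₂.density - 7/8) ^ 2 with hc
  have hc0 : 0 ≤ c := by have := sub_nonneg.2 ht₁; positivity
  have hceq : c = t * (1 - t) * (ω₁.density - ω₂.density) ^ 2 := by
    have e1 : ω₁.density - 7/8 = (1 - t) * (ω₁.density - ω₂.density) := by linarith
    have e2 : ω₂.density - 7/8 = -t * (ω₁.density - ω₂.density) := by linarith
    rw [hc, e1, e2]; ring
  -- the measure `t ν₁ + (1−t) ν₂ + c δ₀` represents the mixture's correlation
  have ha : ((t.toNNReal : ℝ≥0) : ℝ) = t := Real.coe_toNNReal _ ht₀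
  have hb : (((1 - t).toNNReal : ℝ≥0) : ℝ) = 1 - t := Real.coe_toNNReal _ (sub_nonneg.2 ht₁)
  have hcN : ((c.toNNReal : ℝ≥0) : ℝ) = c := Real.coe_toNNReal _ hc0
  set ν : Measure (EuclideanSpace ℝ (Fin 2)) := t.toNNReal • ν₁ + (1 - t).toNNReal • ν₂ with hνdef
  have hνrep := fun r => represents_convexComb ν₁ ν₂ hν₁ hν₂ t.toNNReal (1 - t).toNNReal r
  simp only [ha, hb] at hνrep
  have hν : ∀ r : Site 2, ∫ ξ, exp ((∑ i, (r i : ℝ) * ξ i : ℝ) * I)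
      ∂(ν + c.toNNReal • Measure.dirac (0 : EuclideanSpace ℝ (Fin 2))) =
        chargeOrbitCorr (InfVolFermionState.mix t ht₀ ht₁ ω₁ ω₂) r := by
    intro r
    rw [represents_add_dirac ν hνrep c.toNNReal r, hcN, chargeOrbitCorr_mix_eq ht₀ ht₁ ω₁ ω₂ hω₁ hω₂ r, hc]
  rw [braggWeight_single_eq_of_representing μ hμ (ν + c.toNNReal • Measure.dirac (0 : EuclideanSpace ℝ (Fin 2))) hν
      (0 : Fin 2 → ℝ), braggWeight_add_dirac_zero ν c.toNNReal, hcN, hceq]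
  linarith [braggWeight_nonneg ν ![(0 : Fin 2 → ℝ)]]

/-- **The reading (contrapositive).**  If every finite measure representing `chargeOrbitCorr ω` has `q = 0` Bragg weight
`≤ U` (what a certified UPPER row on the connected density box functional delivers, `densityFluct_braggWeight_le_box3`), then
`ω` is NOT a mixture `t ω₁ + (1−t) ω₂` of translation-invariant states with `t ρ₁ + (1−t) ρ₂ = 7/8` and
`t(1−t)(ρ₁−ρ₂)² > U`: macroscopic phase separation of that contrast is excluded.  (Non-vacuous: a representing measure
exists, `chargeOrbitCorr_representable`.) [cite: BratteliRobinsonI1987, §4.3.1] -/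
theorem not_mix_of_densityFluct_ceiling {ω : InfVolFermionState 2} {U : ℝ}
    (hU : ∀ (μ : Measure (EuclideanSpace ℝ (Fin 2))), IsFiniteMeasure μ →
      (∀ r : Site 2, ∫ ξ, exp ((∑ i, (r i : ℝ) * ξ i : ℝ) * I) ∂μ = chargeOrbitCorr ω r) →
        braggWeight μ ![(0 : Fin 2 → ℝ)] ≤ U)
    {t : ℝ} (ht₀ : 0 ≤ t) (ht₁ : t ≤ 1) (ω₁ ω₂ : InfVolFermionState 2)
    (hω₁ : ω₁.IsTranslationInvariant) (hω₂ : ω₂.IsTranslationInvariant)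
    (hρ : t * ω₁.density + (1 - t) * ω₂.density = 7/8)
    (hgap : U < t * (1 - t) * (ω₁.density - ω₂.density) ^ 2) :
    ω ≠ InfVolFermionState.mix t ht₀ ht₁ ω₁ ω₂ := by
  intro hωeq
  have hti : (InfVolFermionState.mix t ht₀ ht₁ ω₁ ω₂).IsTranslationInvariant := by
    intro v
    ext Λ A
    rw [InfVolFermionState.shift_expect, InfVolFermionState.mix_expect, InfVolFermionState.mix_expect,
      ← InfVolFermionState.shift_expect, ← InfVolFermionState.shift_expect, hω₁ v, hω₂ v]
  obtain ⟨μ, hfin, hμ⟩ := chargeOrbitCorr_representable _ hti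
  have h1 := hU μ hfin (fun r => by rw [hωeq]; exact hμ r)
  have h2 := densityFluct_braggWeight_ge_of_mix ht₀ ht₁ ω₁ ω₂ hω₁ hω₂ hρ μ hμ
  linarith

end Floor

end Summit.Ventures.CertifiedManyBodySolver.Observables

end
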